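import Summits.QuantumFields.YangMills.Theorems.BalabanUVNodesN16HolderDefs
import Summits.QuantumFields.YangMills.Theorems.BalabanUVNodesN16HolderWindow
import HarnessLib

/-!
# Route «BalabanUVNodes», cluster K4 «SpineRates» — node N16 = NE3: THE WINDOW-FREE HÖLDER ROAD (repair R-β″ of the located item
# «the Hölder-exponent pin of N16's N05-socket»), CONSUMER HALF, module 1 of 2: discrete Landau–Kolmogorov WITH A HÖLDER MODULUS along a
# lattice line (transport by the line holonomy), the exponent bookkeeping of the window-free rate `(θ^k)^{(12+14β)∕(1+β)} = ξ²·(θ^{2β∕(1+β)})^k`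
# — GEOMETRICALLY BELOW the plaquette margin `θ^{12k}` FOR EVERY `β > 0` — and «multi-scale β-root ⇒ β-root»

Cell `pub-ymgap`, seat `pub-ymgap-dag-n16-c` (R134 fan-out seat, strategy s1; HUMAN RULING D-0062; chair R424 venue), generation 4, file 20 (kernel evidence
for the located item `HOME/pub-ymgap-dag-n16-c/LOCATED-N16-HOLDER-PIN.md`, census row R-β″ = ADDENDUM 3 (iii); pub-ymgap INBOX DAGN16C-G4-STARTED∕INTENT-1).
`--supports stmt-QuantumFields-19912 --as helper` (K3‴ `SpineGivenEndpointR13`, route rev 16; lineage K3′ 19908).  `bears_on: R4∕N16 · edge N05 → N16 · out-edges N16 → N19∕N21 · GAPS caveat (c2)`.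
Module 2 = `BalabanUVNodesN16HolderMultiScaleRates` (the three closeness coordinates and NE7's consumer END at the window-free rate).

WHY.  The β-root `N16HolderDefs.CovRootHolder d 𝒞 L N b g C Λ₁ Λ₂' β dom` (generation 3) carries, inside its `∃ (u, Z)`, the conjunct (Lip₂′ᶜ)_β «second
transported covariant differences of `Z` at NEAREST-NEIGHBOUR separation ≤ `Λ₂′·ξ^{2+β}`», `ξ = (L⁻¹)^k` — the image at the pair of the (1.36) Hölder member of
[Balaban1985RegularSpaces] Theorem 2 read at ONE lattice step.  Its only consumer, NE7 route #1's one-dimensional interpolation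
`NE7EtaCovariantJunction.norm_covDiff_le_two_sqrt` (‖g‖ ≤ M, second differences ≤ λ₂ ⇒ ‖g 1 − g 0‖ ≤ 2√(Mλ₂)), then yields the covariant-gradient coordinate
(Gᶜ) at `(θ^k)^{10+3β}` (`N16HolderWindow.norm_covDiff_le_rate_holder`), geometric below the margin `θ^{12k}` iff `β > 2∕3` — the WINDOW of the located note.
But print's norm is MULTI-SCALE: [Balaban1985BackgroundPropagators] (3.40) «‖A‖_{1,α} = ‖∇A‖_α = max_{μ,ν} sup_{x,x′:|x−x′|≦1} |x′ − x|^{−α}|R(U(Γ_{x,x′}))(D_μA_ν)(x′)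
− (D_μA_ν)(x)|», ALL pairs up to unit distance (= `L^k` lattice steps at level `k`), transported along a shortest contour — and node N05's leaf of record carries
it so (`B8LeafModelZd3.zdGF3`'s Proposition-3 body is the `msup` of `B9Eq340HolderZd.hquot` over ALL of `AdmPair η len`).  Along a lattice line the shortest
contour is the line itself and its transport is the line holonomy `W(b)W(b+e_μ)⋯W(b+(j−1)e_μ)` of `NE7EtaCovariantJunction` §3.  With the Hölder MODULUS
`‖Ad(hol_j)(D_μZ)(x + j e_μ) − (D_μZ)(x)‖ ≤ H·j^β` (`H = Λ₂′ξ^{2+β}`, `1 ≤ j ≤ L^k`) the Landau–Kolmogorov step improves to `‖D_μZ‖ ≤ 2M∕m + H·m^β` for every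
admissible `m ≥ 1` (§1–§2), and the choice `m ≈ (θ^k)^{−(4+6β)∕(1+β)} ∧ L^k` (module 2) gives (Gᶜ) at `(θ^k)^{(12+14β)∕(1+β)} = ξ²·(θ^{2β∕(1+β)})^k` (§3):
below the margin for EVERY `β > 0`, equal to the landed `θ^{13k}` at `β = 1`, never worse than the nearest-neighbour rate on `β ∈ [0,1]`.  CONSEQUENCE for the
located ruling «R-β ∕ R-Δ ∕ R-min»: with the multi-scale third conjunct node N05's residual Hölder exponent needs only `𝔯.β ∈ (0, 1]` — print's own range
«β ≦ β₀ < 1» — instead of the pin `𝔯.β ∈ (2∕3, 1)`.  The multi-scale β-root is a HYPOTHESIS SHAPE here (nobody's theorem); its producer half (the multi-scale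
pass-through leaf → (OUT_print) → `LandauRepB8` → END) is NOT in these two modules.

WHAT THIS FILE PROVES (kernel, theorems only, 0 `def`, 0 sorry):
§1 `seq_fwdDiff_le_of_sup_of_modulus` (‖g‖ ≤ M, ‖(g(j+1) − g j) − (g 1 − g 0)‖ ≤ ω j for j < m ⇒ ‖g 1 − g 0‖ ≤ 2M∕m + (Σ_{j<m} ω j)∕m),
   `seq_fwdDiff_le_of_sup_of_holderMod` (ω j = H·j^β, 0 ≤ β ⇒ ≤ 2M∕m + H·m^β).
§2 `norm_covDiff_le_of_sup_of_covModulus` ∕ `norm_covDiff_le_of_sup_of_covHolderMod` — the same along a lattice line of a unitary configuration `W`,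
   the sequence transported by the line holonomy (`NE7EtaCovariantJunction.lineHol_succ ∕ lineHol_mem_unitary`).
§3 `rateMS_exponent_eq_eight_add ∕ _eq_twelve_add ∕ _le_fourteen` (bookkeeping), `rateMS_eq_margin_mul` (`(θ^k)^{(12+14β)∕(1+β)} = ((L⁻¹)^k)^2·(θ^{2β∕(1+β)})^k`),
   `rateMS_base_lt_one` (`0 < β ⇒ θ^{2β∕(1+β)} < 1`), `rateMS_le_margin` (`0 ≤ β`), `twelve_lt_rateMS_exponent` (`0 < β`),
   `rateNN_exponent_le_rateMS_exponent` ∕ `rateMS_le_rateNN` (`(θ^k)^{(12+14β)∕(1+β)} ≤ (θ^k)^{10+3β}` on `β ∈ [0,1]`), `rateMS_exponent_one` (`= 13`).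
§4 `lip2h_of_lipMS` (the multi-scale member at `j = 1` IS (Lip₂′ᶜ)_β), `covRootHolder_of_covRootMS` (the eight-conjunct multi-scale β-root implies
   generation 3's `CovRootHolder … β`: nothing landed at exponent β is orphaned by R-β″).
HONEST FRAMING: an elementary interpolation ([folklore]) + exponent bookkeeping over landed modules; the multi-scale β-root is a HYPOTHESIS; nothing of
NE3 ∕ NE7 discharged; N16 ∕ NE3 NOT discharged; count-neutral; one finite four-torus at fixed ε — NOT ℝ⁴, NOT infinite volume, NOT OS, NOT a mass gap, NOT Clay.
-/

set_option autoImplicit false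

open scoped BigOperators Matrix Matrix.Norms.L2Operator
open Finset

namespace Summit.QuantumFields.YangMills.BalabanUVNodes.N16HolderMultiScale

open Literature.MathematicalPhysics.QuantumFieldTheory.Balaban1983to89
open B7Prop1Explicit B7Prop2Explicit
open T4AveragingDeficitWall hiding Site Plane Plaq Bond
open T4AveragingDeficitWallBoundary (periodBox)
open Summit.QuantumFields.BalabanUV.T4Continuum
open AveragingDeficitPeriodicCounting (IsPeriodicDir)
open T4AveragingDeficitNonAbelian (Ad_mul Ad_sub)
open AveragingDeficitTransport (norm_Ad_of_unitary)
open AveragingDeficitNearIdentity (Ad_one)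
open MinimalActionSandwich (IsMinimiser)
open MinimalActionRate (Regular)
open NE3EnergyShapes (residualScale IsUnitarySite IsPeriodicSite)
open NE3EnergyWeightedShapes (energyNormW)
open NE7EtaRatesD4 (scale_eq)
open NE7EtaCovariantJunction (lineHol_succ lineHol_mem_unitary)
open N16HolderDefs (CovRootHolder)
open Summit.QuantumFields.YangMills.Theorems.N21ClosenessJunction (theta_lt_one)

noncomputable section

/-! ## §1 Discrete Landau–Kolmogorov for sequences WITH A MODULUS on the forward differences -/

section SeqLK

variable {E : Type*} [NormedAddCommGroup E] [NormedSpace ℝ E]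

/-- **SEQUENCE LANDAU–KOLMOGOROV WITH A MODULUS** (two-term form): `‖g j‖ ≤ M` for all `j`, and the forward difference `j` steps ahead differs from
the first one by at most `ω j` for `j < m` (`m ≥ 1`) ⇒ `‖g 1 − g 0‖ ≤ 2M∕m + (Σ_{j<m} ω j)∕m`.  (`NE7EtaCovariantJunction.seq_fwdDiff_le_of_sup_of_second` is the
case `ω j = j·λ₂` of a nearest-neighbour second-difference bound.) [folklore] -/
theorem seq_fwdDiff_le_of_sup_of_modulus (g : ℕ → E) {M : ℝ} (ω : ℕ → ℝ) (hM : ∀ j, ‖g j‖ ≤ M) {m : ℕ} (hm : 1 ≤ m)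
    (hω : ∀ j : ℕ, j < m → ‖(g (j + 1) - g j) - (g 1 - g 0)‖ ≤ ω j) :
    ‖g 1 - g 0‖ ≤ 2 * M / m + (∑ j ∈ Finset.range m, ω j) / m := by
  set D : E := g 1 - g 0 with hD
  have htel : g m - g 0 = ∑ j ∈ Finset.range m, (g (j + 1) - g j) := (Finset.sum_range_sub g m).symm
  have hsum : ∑ j ∈ Finset.range m, (g (j + 1) - g j) = m • D + ∑ j ∈ Finset.range m, ((g (j + 1) - g j) - D) := by
    simp only [Finset.sum_sub_distrib, Finset.sum_const, Finset.card_range]; abel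
  have hkey : (m : ℕ) • D = (g m - g 0) - ∑ j ∈ Finset.range m, ((g (j + 1) - g j) - D) := by
    rw [htel, hsum]; abel
  have hn1 : ‖g m - g 0‖ ≤ 2 * M := by
    calc ‖g m - g 0‖ ≤ ‖g m‖ + ‖g 0‖ := norm_sub_le _ _
      _ ≤ M + M := add_le_add (hM _) (hM _)
      _ = 2 * M := by ring
  have hn2 : ‖∑ j ∈ Finset.range m, ((g (j + 1) - g j) - D)‖ ≤ ∑ j ∈ Finset.range m, ω j :=
    (norm_sum_le _ _).trans (Finset.sum_le_sum fun j hj => hω j (Finset.mem_range.mp hj))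
  have hmpos : (0 : ℝ) < m := by exact_mod_cast hm
  have hnorm : (m : ℝ) * ‖D‖ ≤ 2 * M + ∑ j ∈ Finset.range m, ω j := by
    have : ‖(m : ℕ) • D‖ = (m : ℝ) * ‖D‖ := by
      rw [← Nat.cast_smul_eq_nsmul ℝ, norm_smul, Real.norm_natCast]
    rw [← this, hkey]
    exact (norm_sub_le _ _).trans (add_le_add hn1 hn2)
  have : ‖D‖ ≤ (2 * M + ∑ j ∈ Finset.range m, ω j) / m := by
    rw [le_div_iff₀ hmpos]; linarith
  calc ‖g 1 - g 0‖ = ‖D‖ := rfl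
    _ ≤ (2 * M + ∑ j ∈ Finset.range m, ω j) / m := this
    _ = 2 * M / m + (∑ j ∈ Finset.range m, ω j) / m := by rw [add_div]

/-- **SEQUENCE LANDAU–KOLMOGOROV WITH A HÖLDER MODULUS**: `‖g j‖ ≤ M` for all `j`, `‖(g (j+1) − g j) − (g 1 − g 0)‖ ≤ H·j^β` for `1 ≤ j < m` (`H ≥ 0`,
`β ≥ 0`, real power) ⇒ `‖g 1 − g 0‖ ≤ 2M∕m + H·m^β` for every `m ≥ 1`. [folklore] -/
theorem seq_fwdDiff_le_of_sup_of_holderMod (g : ℕ → E) {M H β : ℝ} (hβ : 0 ≤ β) (hH : 0 ≤ H) (hM : ∀ j, ‖g j‖ ≤ M) {m : ℕ}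
    (hm : 1 ≤ m) (hω : ∀ j : ℕ, 1 ≤ j → j < m → ‖(g (j + 1) - g j) - (g 1 - g 0)‖ ≤ H * (j : ℝ) ^ β) :
    ‖g 1 - g 0‖ ≤ 2 * M / m + H * (m : ℝ) ^ β := by
  have hω' : ∀ j : ℕ, j < m → ‖(g (j + 1) - g j) - (g 1 - g 0)‖ ≤ H * (m : ℝ) ^ β := by
    intro j hj
    rcases Nat.eq_zero_or_pos j with rfl | hj1
    · simp only [zero_add, sub_self, norm_zero]
      exact mul_nonneg hH (Real.rpow_nonneg (Nat.cast_nonneg m) β)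
    · calc ‖(g (j + 1) - g j) - (g 1 - g 0)‖ ≤ H * (j : ℝ) ^ β := hω j hj1 hj
        _ ≤ H * (m : ℝ) ^ β :=
          mul_le_mul_of_nonneg_left (Real.rpow_le_rpow (Nat.cast_nonneg j) (by exact_mod_cast hj.le) hβ) hH
  have h := seq_fwdDiff_le_of_sup_of_modulus g (fun _ => H * (m : ℝ) ^ β) hM hm hω'
  have hmpos : (0 : ℝ) < m := by exact_mod_cast hm
  have hs : (∑ _j ∈ Finset.range m, H * (m : ℝ) ^ β) / m = H * (m : ℝ) ^ β := by
    rw [Finset.sum_const, Finset.card_range, nsmul_eq_mul]; field_simp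
  rw [hs] at h
  exact h

end SeqLK

/-! ## §2 Along a lattice line: the covariant Landau–Kolmogorov step with a (Hölder) modulus on the TRANSPORTED covariant differences -/

section Transport

variable {d : ℕ} {n : Type*} [Fintype n] [DecidableEq n]

/-- **THE COVARIANT LANDAU–KOLMOGOROV STEP WITH A MODULUS.**  `W` unitary; `‖Z y κ‖ ≤ M` for all `y`; along the `μ`-line through `x` the covariant
difference `(D_μZ)(x + j•e_μ) = Ad (W (x + e κ + j•e μ) μ) (Z (x + (j+1)•e μ) κ) − Z (x + j•e μ) κ`, transported back to `x` by the line holonomy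
`W (x + e κ) μ · W (x + e κ + e μ) μ ⋯ W (x + e κ + (j−1)•e μ) μ` (the transport «R(U(Γ_{x,x′}))» of [Balaban1985BackgroundPropagators] (3.40) along the
straight contour), differs from `(D_μZ)(x)` by at most `ω j` for `1 ≤ j < m`, with `ω 0 ≥ 0`.  THEN
`‖(D_μZ)(x)‖ ≤ 2M∕m + (Σ_{j<m} ω j)∕m`.  Proof = `NE7EtaCovariantJunction.norm_covDiff_le_two_sqrt`'s (transport the sequence `Z (x + j•e μ) κ` to the
base; norms are preserved, forward differences are transported covariant differences) with §1 in place of the λ₂-interpolation.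
[cite: Balaban1985BackgroundPropagators, (3.40) p.397] [folklore] -/
theorem norm_covDiff_le_of_sup_of_covModulus {W : Site d → Fin d → (Matrix n n ℂ)ˣ} (hW : IsUnitaryCfg W)
    {Z : Site d → Fin d → Matrix n n ℂ} (κ μ : Fin d) {M : ℝ} (ω : ℕ → ℝ) (hM : ∀ y, ‖Z y κ‖ ≤ M) (x : Site d)
    {m : ℕ} (hm : 1 ≤ m)
    (hω : ∀ j : ℕ, 1 ≤ j → j < m →
      ‖Ad (((List.range j).map fun i : ℕ => W (x + e κ + i • e μ) μ).prod)
            (Ad (W (x + e κ + j • e μ) μ) (Z (x + (j + 1) • e μ) κ) - Z (x + j • e μ) κ)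
        - (Ad (W (x + e κ) μ) (Z (x + e μ) κ) - Z x κ)‖ ≤ ω j)
    (hω0 : 0 ≤ ω 0) :
    ‖Ad (W (x + e κ) μ) (Z (x + e μ) κ) - Z x κ‖ ≤ 2 * M / m + (∑ j ∈ Finset.range m, ω j) / m := by
  -- the line holonomy from the base `x + e κ` and the transported sequence `g`
  have hHs : ∀ j : ℕ, ((List.range (j + 1)).map fun i : ℕ => W (x + e κ + i • e μ) μ).prod
      = ((List.range j).map fun i : ℕ => W (x + e κ + i • e μ) μ).prod * W (x + e κ + j • e μ) μ :=
    fun j => lineHol_succ W (x + e κ) μ j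
  have hHu : ∀ j : ℕ, ((List.range j).map fun i : ℕ => W (x + e κ + i • e μ) μ).prod ∈ unitaryUnits (Matrix n n ℂ) :=
    fun j => lineHol_mem_unitary hW (x + e κ) μ j
  set g : ℕ → Matrix n n ℂ := fun j => Ad (((List.range j).map fun i : ℕ => W (x + e κ + i • e μ) μ).prod) (Z (x + j • e μ) κ)
    with hg
  have hdiff : ∀ j : ℕ, g (j + 1) - g j = Ad (((List.range j).map fun i : ℕ => W (x + e κ + i • e μ) μ).prod)
      (Ad (W (x + e κ + j • e μ) μ) (Z (x + (j + 1) • e μ) κ) - Z (x + j • e μ) κ) := by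
    intro j; simp only [hg]; rw [hHs, Ad_mul, Ad_sub]
  have e1 : g 1 - g 0 = Ad (W (x + e κ) μ) (Z (x + e μ) κ) - Z x κ := by
    rw [show (1 : ℕ) = 0 + 1 by rfl, hdiff 0]
    simp only [List.range_zero, List.map_nil, List.prod_nil, Ad_one, zero_smul, add_zero, zero_add, one_smul]
  have hgn : ∀ j, ‖g j‖ ≤ M := fun j => by
    simp only [hg]; rw [norm_Ad_of_unitary (hHu j)]; exact hM _
  have hgω : ∀ j : ℕ, j < m → ‖(g (j + 1) - g j) - (g 1 - g 0)‖ ≤ ω j := by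
    intro j hj
    rcases Nat.eq_zero_or_pos j with rfl | hj1
    · simpa using hω0
    · rw [hdiff j, e1]
      exact hω j hj1 hj
  have h := seq_fwdDiff_le_of_sup_of_modulus g ω hgn hm hgω
  rw [e1] at h
  exact h

/-- **THE COVARIANT LANDAU–KOLMOGOROV STEP WITH A HÖLDER MODULUS**: same data, modulus `ω j = H·j^β` for `1 ≤ j < m` (`H ≥ 0`, `β ≥ 0`) ⇒
`‖Ad (W (x + e κ) μ) (Z (x + e μ) κ) − Z x κ‖ ≤ 2M∕m + H·m^β` for every `m ≥ 1`. [cite: Balaban1985BackgroundPropagators, (3.40) p.397] [folklore] -/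
theorem norm_covDiff_le_of_sup_of_covHolderMod {W : Site d → Fin d → (Matrix n n ℂ)ˣ} (hW : IsUnitaryCfg W)
    {Z : Site d → Fin d → Matrix n n ℂ} (κ μ : Fin d) {M H β : ℝ} (hβ : 0 ≤ β) (hH : 0 ≤ H) (hM : ∀ y, ‖Z y κ‖ ≤ M)
    (x : Site d) {m : ℕ} (hm : 1 ≤ m)
    (hω : ∀ j : ℕ, 1 ≤ j → j < m →
      ‖Ad (((List.range j).map fun i : ℕ => W (x + e κ + i • e μ) μ).prod)
            (Ad (W (x + e κ + j • e μ) μ) (Z (x + (j + 1) • e μ) κ) - Z (x + j • e μ) κ)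
        - (Ad (W (x + e κ) μ) (Z (x + e μ) κ) - Z x κ)‖ ≤ H * (j : ℝ) ^ β) :
    ‖Ad (W (x + e κ) μ) (Z (x + e μ) κ) - Z x κ‖ ≤ 2 * M / m + H * (m : ℝ) ^ β := by
  have hω' : ∀ j : ℕ, 1 ≤ j → j < m →
      ‖Ad (((List.range j).map fun i : ℕ => W (x + e κ + i • e μ) μ).prod)
            (Ad (W (x + e κ + j • e μ) μ) (Z (x + (j + 1) • e μ) κ) - Z (x + j • e μ) κ)
        - (Ad (W (x + e κ) μ) (Z (x + e μ) κ) - Z x κ)‖ ≤ (fun _ : ℕ => H * (m : ℝ) ^ β) j := by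
    intro j hj1 hj
    exact (hω j hj1 hj).trans
      (mul_le_mul_of_nonneg_left (Real.rpow_le_rpow (Nat.cast_nonneg j) (by exact_mod_cast hj.le) hβ) hH)
  have h0 : 0 ≤ (fun _ : ℕ => H * (m : ℝ) ^ β) 0 := mul_nonneg hH (Real.rpow_nonneg (Nat.cast_nonneg m) β)
  have h := norm_covDiff_le_of_sup_of_covModulus hW κ μ (fun _ : ℕ => H * (m : ℝ) ^ β) hM x hm hω' h0
  have hmpos : (0 : ℝ) < m := by exact_mod_cast hm
  have hs : (∑ _j ∈ Finset.range m, H * (m : ℝ) ^ β) / m = H * (m : ℝ) ^ β := by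
    rw [Finset.sum_const, Finset.card_range, nsmul_eq_mul]; field_simp
  simp only [hs] at h
  exact h

end Transport

/-! ## §3 No window: the exponent `(12+14β)∕(1+β)`, and `(θ^k)^{(12+14β)∕(1+β)} = ξ²·(θ^{2β∕(1+β)})^k` below the margin for EVERY `β > 0` -/

section Window

/-- Exponent bookkeeping: `(12 + 14β)∕(1 + β) = 8 + (4 + 6β)∕(1 + β)` (`β ≥ 0`). [folklore] -/
theorem rateMS_exponent_eq_eight_add {β : ℝ} (hβ : 0 ≤ β) :
    ((12 : ℝ) + 14 * β) / (1 + β) = 8 + (4 + 6 * β) / (1 + β) := by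
  have h1 : (1 : ℝ) + β ≠ 0 := by linarith
  field_simp
  ring

/-- Exponent bookkeeping: `(12 + 14β)∕(1 + β) = 12 + 6β − ((4 + 6β)∕(1 + β))·β` (`β ≥ 0`). [folklore] -/
theorem rateMS_exponent_eq_twelve_add {β : ℝ} (hβ : 0 ≤ β) :
    ((12 : ℝ) + 14 * β) / (1 + β) = 12 + 6 * β - (4 + 6 * β) / (1 + β) * β := by
  have h1 : (1 : ℝ) + β ≠ 0 := by linarith
  field_simp
  ring

/-- Exponent bookkeeping: `(12 + 14β)∕(1 + β) ≤ 14` (`β ≥ 0`). [folklore] -/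
theorem rateMS_exponent_le_fourteen {β : ℝ} (hβ : 0 ≤ β) : ((12 : ℝ) + 14 * β) / (1 + β) ≤ 14 := by
  rw [div_le_iff₀ (by linarith)]
  linarith


/-- **THE SPLIT OF THE MULTI-SCALE RATE AGAINST THE PLAQUETTE MARGIN**: `(θ^k)^{(12+14β)∕(1+β)} = ((L⁻¹)^k)^2 · (θ^{2β∕(1+β)})^k` (`θ⁶ = L⁻¹`, `θ > 0`,
`L ≥ 1`, `β ≥ 0`) — the margin `ξ² = θ^{12k}` times a per-level factor `θ^{2β∕(1+β)}`. [folklore] -/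
theorem rateMS_eq_margin_mul {L : ℕ} (hL : 1 ≤ L) {θ : ℝ} (hθ : 0 < θ) (hθ6 : θ ^ 6 = ((L : ℝ))⁻¹) {β : ℝ} (hβ : 0 ≤ β) (k : ℕ) :
    (θ ^ k) ^ (((12 : ℝ) + 14 * β) / (1 + β)) = (((L : ℝ)⁻¹) ^ k) ^ 2 * (θ ^ ((2 : ℝ) * β / (1 + β))) ^ k := by
  obtain ⟨hξ, -⟩ := scale_eq hL hθ6 k
  have hs : 0 < θ ^ k := pow_pos hθ k
  have h1 : (1 : ℝ) + β ≠ 0 := by linarith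
  rw [hξ]
  have h12 : ((θ ^ k) ^ 6) ^ 2 = (θ ^ k) ^ (12 : ℝ) := by
    rw [← pow_mul, show (12 : ℝ) = ((12 : ℕ) : ℝ) by norm_num, Real.rpow_natCast]
  have hsw : (θ ^ ((2 : ℝ) * β / (1 + β))) ^ k = (θ ^ k) ^ ((2 : ℝ) * β / (1 + β)) := by
    rw [← Real.rpow_natCast (θ ^ ((2 : ℝ) * β / (1 + β))) k, ← Real.rpow_mul hθ.le, mul_comm, Real.rpow_mul hθ.le,
      Real.rpow_natCast]
  have hexp : ((12 : ℝ) + 14 * β) / (1 + β) = 12 + (2 : ℝ) * β / (1 + β) := by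
    field_simp; ring
  rw [h12, hsw, ← Real.rpow_add hs, hexp]

/-- **NO WINDOW**: for EVERY `β > 0` the per-level factor is a genuine rate, `θ^{2β∕(1+β)} < 1` (`0 < θ < 1`). [folklore] -/
theorem rateMS_base_lt_one {θ β : ℝ} (hθ : 0 < θ) (hθ1 : θ < 1) (hβ : 0 < β) : θ ^ ((2 : ℝ) * β / (1 + β)) < 1 :=
  Real.rpow_lt_one hθ.le hθ1 (div_pos (by linarith) (by linarith))

/-- … and it is at most `1` for `β ≥ 0`, so the three coordinates of module 2 are AT OR BELOW the plaquette margin: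
`(θ^k)^{(12+14β)∕(1+β)} ≤ ((L⁻¹)^k)^2` (`θ⁶ = L⁻¹`, `L ≥ 2`). [folklore] -/
theorem rateMS_le_margin {L : ℕ} (hL : 2 ≤ L) {θ : ℝ} (hθ : 0 < θ) (hθ6 : θ ^ 6 = ((L : ℝ))⁻¹) {β : ℝ} (hβ : 0 ≤ β) (k : ℕ) :
    (θ ^ k) ^ (((12 : ℝ) + 14 * β) / (1 + β)) ≤ (((L : ℝ)⁻¹) ^ k) ^ 2 := by
  rw [rateMS_eq_margin_mul (by omega) hθ hθ6 hβ k]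
  have hθ1 : θ < 1 := theta_lt_one hL hθ6
  have hb1 : θ ^ ((2 : ℝ) * β / (1 + β)) ≤ 1 :=
    Real.rpow_le_one hθ.le hθ1.le (div_nonneg (by linarith) (by linarith))
  calc (((L : ℝ)⁻¹) ^ k) ^ 2 * (θ ^ ((2 : ℝ) * β / (1 + β))) ^ k ≤ (((L : ℝ)⁻¹) ^ k) ^ 2 * 1 :=
        mul_le_mul_of_nonneg_left (pow_le_one₀ (Real.rpow_nonneg hθ.le _) hb1) (by positivity)
    _ = (((L : ℝ)⁻¹) ^ k) ^ 2 := mul_one _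

/-- The multi-scale exponent exceeds the margin's `12` for EVERY `β > 0` (the nearest-neighbour exponent `10 + 3β` does so only for `β > 2∕3`).
[folklore] -/
theorem twelve_lt_rateMS_exponent {β : ℝ} (hβ : 0 < β) : (12 : ℝ) < ((12 : ℝ) + 14 * β) / (1 + β) := by
  rw [lt_div_iff₀ (by linarith)]
  linarith

/-- On `β ∈ [0, 1]` the multi-scale exponent is at least the nearest-neighbour one: `10 + 3β ≤ (12+14β)∕(1+β)` (`(3β + 2)(β − 1) ≤ 0`). [folklore] -/
theorem rateNN_exponent_le_rateMS_exponent {β : ℝ} (hβ0 : 0 ≤ β) (hβ1 : β ≤ 1) :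
    (10 : ℝ) + 3 * β ≤ ((12 : ℝ) + 14 * β) / (1 + β) := by
  rw [le_div_iff₀ (by linarith)]
  nlinarith

/-- … so the multi-scale rate is NEVER WORSE than the nearest-neighbour rate of `N16HolderWindow` §1: `(θ^k)^{(12+14β)∕(1+β)} ≤ (θ^k)^{10+3β}`
(`0 < θ ≤ 1`, `β ∈ [0,1]`); at `β = 1` both are the landed `θ^{13k}`. [folklore] -/
theorem rateMS_le_rateNN {θ : ℝ} (hθ : 0 < θ) (hθ1 : θ ≤ 1) {β : ℝ} (hβ0 : 0 ≤ β) (hβ1 : β ≤ 1) (k : ℕ) :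
    (θ ^ k) ^ (((12 : ℝ) + 14 * β) / (1 + β)) ≤ (θ ^ k) ^ ((10 : ℝ) + 3 * β) :=
  Real.rpow_le_rpow_of_exponent_ge (pow_pos hθ k) (pow_le_one₀ hθ.le hθ1) (rateNN_exponent_le_rateMS_exponent hβ0 hβ1)

/-- At `β = 1` the multi-scale exponent is `13` — the rate `θ^{13k}` of the decls of record. [folklore] -/
theorem rateMS_exponent_one : ((12 : ℝ) + 14 * 1) / (1 + 1) = 13 := by norm_num

end Window

/-! ## §4 The multi-scale member at `j = 1` IS (Lip₂′ᶜ)_β: the multi-scale β-root implies generation 3's `CovRootHolder … β` -/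

section ToHolder

variable {d : ℕ} {n : Type*} [Fintype n] [DecidableEq n]

/-- **THE MULTI-SCALE MEMBER AT ONE STEP IS THE NEAREST-NEIGHBOUR MEMBER**: the line holonomy of length one is the single bond variable
`W (y + e κ) μ` and `1^β = 1`, so (Lip₂ᴹˢ)_β with constant `H` (any range bound `J ≥ 1`) gives (Lip₂′ᶜ)_β with the same constant:
`‖Ad (W (y+e κ) μ) (Ad (W (y+e κ+e μ) μ) (Z (y+2•e μ) κ) − Z (y+e μ) κ) − (Ad (W (y+e κ) μ) (Z (y+e μ) κ) − Z y κ)‖ ≤ H`. [folklore] -/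
theorem lip2h_of_lipMS {W : Site d → Fin d → (Matrix n n ℂ)ˣ} {Z : Site d → Fin d → Matrix n n ℂ} {H β : ℝ} {J : ℕ} (hJ : 1 ≤ J)
    (h : ∀ (κ μ : Fin d) (y : Site d) (j : ℕ), 1 ≤ j → j ≤ J →
      ‖Ad (((List.range j).map fun i : ℕ => W (y + e κ + i • e μ) μ).prod)
            (Ad (W (y + e κ + j • e μ) μ) (Z (y + (j + 1) • e μ) κ) - Z (y + j • e μ) κ)
        - (Ad (W (y + e κ) μ) (Z (y + e μ) κ) - Z y κ)‖ ≤ H * (j : ℝ) ^ β)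
    (κ μ : Fin d) (y : Site d) :
    ‖Ad (W (y + e κ) μ) (Ad (W (y + e κ + e μ) μ) (Z (y + (2 : ℕ) • e μ) κ) - Z (y + e μ) κ)
        - (Ad (W (y + e κ) μ) (Z (y + e μ) κ) - Z y κ)‖ ≤ H := by
  have h1 := h κ μ y 1 le_rfl hJ
  simp only [List.range_one, List.map_cons, List.map_nil, List.prod_cons, List.prod_nil, mul_one, zero_smul, add_zero,
    one_smul, Nat.cast_one, Real.one_rpow, mul_one] at h1
  exact h1

/-- **THE MULTI-SCALE β-ROOT IMPLIES THE β-ROOT** (any `d`, `L ≥ 1`): the eight-conjunct covariant root with the multi-scale third conjunct (the hypothesis `h` of module 2's `closeness_of_covRoot_holderMS`)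
gives generation 3's `N16HolderDefs.CovRootHolder d 𝒞 L N b g C Λ₁ Λ₂' β dom` — its (Lip₂′ᶜ)_β is the multi-scale member at `j = 1 ≤ L^k`.  So every
theorem landed at exponent β (the producer column `N16HolderConst ∕ OfThm4Output ∕ OfLeaf`, the record kit `N16HolderRegime ∕ LeafSlot`, N21's
`N21HolderWidth`, N19's `N19LiaisonC1Holder`) stays available under R-β″; what R-β″ ADDS is module 2's window-free rate. [folklore] -/
theorem covRootHolder_of_covRootMS {𝒞 : ℕ → Set (Site d → Fin d → (Matrix n n ℂ)ˣ)} {L N : ℕ} (hL : 1 ≤ L) {b g C Λ₁ Λ₂' β : ℝ}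
    {dom : Set (Site d → Fin d → (Matrix n n ℂ)ˣ)}
    (h : ∀ k : ℕ, 1 ≤ k → ∀ V ∈ dom, ∀ UA UB : Site d → Fin d → (Matrix n n ℂ)ˣ,
      IsMinimiser d 𝒞 L N k V UA → IsMinimiser d 𝒞 L N (k + 1) V UB → Regular d L N b g (k + 1) UB →
        ∃ (u : Site d → (Matrix n n ℂ)ˣ) (Z : Site d → Fin d → Matrix n n ℂ),
          IsUnitarySite u ∧ IsPeriodicSite u ((N * L ^ k : ℕ) : ℤ) ∧
          IsSkewDir Z ∧ IsPeriodicDir Z ((N * L ^ k : ℕ) : ℤ) ∧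
          gaugeAct u UA = vary (rescale L (bavg L UB)) Z 1 ∧
          energyNormW L k (rescale L (bavg L UB)) Z (periodBox (N * L ^ k)) ≤ C * residualScale d L N b g k ∧
          (∀ (κ : Fin d) (x : Site d) (μ : Fin d),
            ‖Ad (rescale L (bavg L UB) (x + e κ) μ) (Z (x + e μ) κ) - Z x κ‖ ≤ Λ₁ * (((L : ℝ)⁻¹) ^ k) ^ 2) ∧
          (∀ (κ μ : Fin d) (y : Site d) (j : ℕ), 1 ≤ j → j ≤ L ^ k →
            ‖Ad (((List.range j).map fun i : ℕ => rescale L (bavg L UB) (y + e κ + i • e μ) μ).prod)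
                  (Ad (rescale L (bavg L UB) (y + e κ + j • e μ) μ) (Z (y + (j + 1) • e μ) κ) - Z (y + j • e μ) κ)
              - (Ad (rescale L (bavg L UB) (y + e κ) μ) (Z (y + e μ) κ) - Z y κ)‖
              ≤ Λ₂' * (((L : ℝ)⁻¹) ^ k) ^ ((2 : ℝ) + β) * (j : ℝ) ^ β)) :
    CovRootHolder d 𝒞 L N b g C Λ₁ Λ₂' β dom := by
  intro k hk V hV UA UB hA hB hreg
  obtain ⟨u, Z, hu, huP, hZ, hZP, hrep, hE, h1, h2⟩ := h k hk V hV UA UB hA hB hreg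
  exact ⟨u, Z, hu, huP, hZ, hZP, hrep, hE, h1, lip2h_of_lipMS (Nat.one_le_pow k L hL) h2⟩

end ToHolder

end

end Summit.QuantumFields.YangMills.BalabanUVNodes.N16HolderMultiScale
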